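import Mathlib.Tactic

/-!
# The live line of the generic one-type universe (pub-hsemireg, W2 seat w2-t1-1, gen 23, item (iii))

Kernel transcription of the PEN CORE of COROLLARY (41-L) of the record memo
`widen/W2/w2t11/LIVELAW-w2t11g23.md`.  LINEAGE SIDE (not formalised; symbolic ×1 by
`symlaw/liveproof/solvesym.py`, `cornersym.py`, `extrasym.py`, outputs sha256/16 in the memo;
text-level on 205 986 census verdict rows, 0 deviations): in the one-type-per-pencil live system of a
class `τ = (τ0, τ1)` with weights `W = (w_a, w_b)` the solutions form the line
`n_i = -E(W) / (N(Δ) W_i)`, `H̄(m') = H̄⁰(W) - m' · τ τ*` with `u* H̄⁰ u = A - w_a - w_b`,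
`det H̄⁰ = -E(W)/N(Δ)` (`u = Jᵀ conj τ`), and at the corner `W = (A/2, A/2)` of a rational class
`H̄⁰ = (2/A) τ τ*`; hence LIVE `↔ E < 0 ∨` corner, `sup m' = (-E/N(Δ))/(A - w_a - w_b)` resp. `2/A`.
WHAT IS CHECKED HERE (explicit polynomial / ordered-field statements, no definitions).  Conjugation
is modelled by independent variables: `t0 t1` stand for `τ0 τ1`, `T0 T1` for their conjugates
(`N τ0 = t0 * T0`, `A = N τ0 + N τ1 + N (τ0 - τ1)`, `4 N(Δ) = A² - 9 y²`); a Hermitian `2 × 2`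
matrix is `h11 h22 h12 h21` with `h21` standing for `conj h12`; `u = (-T1, T0)`, `conj u = (-t1, t0)`.
* `tau_orth_u`: `τ* u = 0`;  `uHu_eq`: `u* H u = N τ1 · h11 + N τ0 · h22 - T0 t1 · h12 - t0 T1 · h21`;
* `det_rank_one_update`: `det (H - m · τ τ*) = det H - m · (u* H u)` (the `m²` term vanishes) — so
  `det H̄(m')` is LINEAR on the line (GENLIVE (G4)'s "t² coefficient A = 0");
* `det_on_line`: with `det H̄⁰ = dH`, `u* H̄⁰ u = q`: `det (H̄⁰ - m ττ*) = dH - m q`;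
  `det_nonneg_iff`: for `0 < q`, `0 ≤ dH - m q ↔ m ≤ dH / q` (the sup-`m'` formula);
* `offdiag_skew_on_line`: for real symmetric `H̄⁰` (`h12 = h21`) the skew part of `H̄(m')` is
  `-m' (t0 T1 - t1 T0)` (`= -m' y √-3`: `m'` is read off the imaginary part);
* `four_E`: `4 E = 3 (w_a + w_b - 2A/3)² + (w_a - w_b)² - 4N/3` for
  `E = Q(w_a - A/3, w_b - A/3) - N/3`;  `sum_lt_of_E_neg`: `0 < A`, `4 N ≤ A²`, `E < 0 ⟹ w_a + w_b < A`
  (so `u* H̄⁰ u > 0` on every cell with `E < 0`);  `sum_le_of_E_zero` and `corner_of_E_zero_sum_eq`: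
  `E = 0 ⟹ w_a + w_b ≤ A`, with equality only at `w_a = w_b` and `4 N = A²` (the corner, `y = 0`);
* `n_pos_iff`: for `0 < N`, `0 < w`: `0 < -E / (N w) ↔ E < 0`;  `E_corner`: `E(A/2, A/2) = 0` when
  `4 N = A²`;  `corner_sup`: `0 ≤ 2/A - m ↔ m ≤ 2/A`.
RECORD ONLY; W2 counts 0 ∕ 0 ∕ 0 unchanged.  Honest framing: nothing here says HC / HC_CM / HC_AV
is proved.
-/

namespace Summit.Ventures.HSemireg.LiveLineLaw

variable {R : Type*} [CommRing R]
variable {F : Type*} [Field F] [LinearOrder F] [IsStrictOrderedRing F]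

/-! ## The vector `u = Jᵀ conj τ = (-T1, T0)` and the rank-one update -/

/-- `τ* u = conj τ0 · (-T1) + conj τ1 · T0 = 0`: `u` is orthogonal to `τ`. -/
theorem tau_orth_u (T0 T1 : R) : T0 * (-T1) + T1 * T0 = 0 := by
  ring

/-- `u* H u` for `H = [[h11, h12], [h21, h22]]`, `u = (-T1, T0)`, `conj u = (-t1, t0)`:
`conj u0 (h11 u0 + h12 u1) + conj u1 (h21 u0 + h22 u1) = N τ1 h11 + N τ0 h22 - T0 t1 h12 - t0 T1 h21`. -/
theorem uHu_eq (t0 t1 T0 T1 h11 h22 h12 h21 : R) :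
    (-t1) * (h11 * (-T1) + h12 * T0) + t0 * (h21 * (-T1) + h22 * T0)
      = t1 * T1 * h11 + t0 * T0 * h22 - T0 * t1 * h12 - t0 * T1 * h21 := by
  ring

/-- RANK-ONE UPDATE: `det (H - m · τ τ*) = det H - m · (u* H u)`; the `m²` coefficient
`N τ0 · N τ1 - (τ0 conj τ1)(τ1 conj τ0)` vanishes identically.  (`τ τ*` has entries
`t0 T0, t0 T1 ; t1 T0, t1 T1`.) -/
theorem det_rank_one_update (t0 t1 T0 T1 h11 h22 h12 h21 m : R) :
    (h11 - m * (t0 * T0)) * (h22 - m * (t1 * T1)) - (h12 - m * (t0 * T1)) * (h21 - m * (t1 * T0))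
      = (h11 * h22 - h12 * h21)
        - m * (t1 * T1 * h11 + t0 * T0 * h22 - T0 * t1 * h12 - t0 * T1 * h21) := by
  ring

/-- On the line: if `det H̄⁰ = dH` and `u* H̄⁰ u = q` then `det (H̄⁰ - m ττ*) = dH - m q`
(with `dH = -E/N(Δ)`, `q = A - w_a - w_b` by THEOREM (41-L) (L2)). -/
theorem det_on_line (t0 t1 T0 T1 h11 h22 h12 h21 m dH q : R)
    (hdet : h11 * h22 - h12 * h21 = dH)
    (hq : t1 * T1 * h11 + t0 * T0 * h22 - T0 * t1 * h12 - t0 * T1 * h21 = q) :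
    (h11 - m * (t0 * T0)) * (h22 - m * (t1 * T1)) - (h12 - m * (t0 * T1)) * (h21 - m * (t1 * T0))
      = dH - m * q := by
  rw [det_rank_one_update, hdet, hq]

/-- The sup-`m'` formula: for `0 < q`, `0 ≤ dH - m q ↔ m ≤ dH / q`. -/
theorem det_nonneg_iff (m dH q : F) (hq : 0 < q) : 0 ≤ dH - m * q ↔ m ≤ dH / q := by
  rw [le_div_iff₀ hq, sub_nonneg]

/-- For a real symmetric `H̄⁰` (`h12 = h21`, THEOREM (41-L) (L1)) the skew part of
`H̄(m') = H̄⁰ - m' ττ*` is `(h12 - m' t0 T1) - (h21 - m' t1 T0) = -m' (t0 T1 - t1 T0)`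
(`= -m' · y √-3`). -/
theorem offdiag_skew_on_line (t0 t1 T0 T1 h12 h21 m : R) (hsym : h12 = h21) :
    (h12 - m * (t0 * T1)) - (h21 - m * (t1 * T0)) = -(m * (t0 * T1 - t1 * T0)) := by
  subst hsym
  ring

/-! ## The ellipse quantity `E(W) = Q(w_a - A/3, w_b - A/3) - N/3` -/

/-- `4 E = 3 (w_a + w_b - 2A/3)² + (w_a - w_b)² - 4N/3`. -/
theorem four_E (A N wa wb : F) :
    4 * ((wa - A / 3) ^ 2 + (wa - A / 3) * (wb - A / 3) + (wb - A / 3) ^ 2 - N / 3)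
      = 3 * (wa + wb - 2 * A / 3) ^ 2 + (wa - wb) ^ 2 - 4 * N / 3 := by
  ring

/-- `E < 0` (with `0 < A`, `4 N ≤ A²`, i.e. `N = (A² - 9y²)/4`) forces `w_a + w_b < A`:
hence `u* H̄⁰ u = A - w_a - w_b > 0` on every cell with `E < 0`. -/
theorem sum_lt_of_E_neg (A N wa wb : F) (hA : 0 < A) (hN : 4 * N ≤ A ^ 2)
    (hE : (wa - A / 3) ^ 2 + (wa - A / 3) * (wb - A / 3) + (wb - A / 3) ^ 2 - N / 3 < 0) :
    wa + wb < A := by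
  by_contra h
  rw [not_lt] at h
  have h1 : A / 3 ≤ wa + wb - 2 * A / 3 := by linarith
  have h2 : (A / 3) ^ 2 ≤ (wa + wb - 2 * A / 3) ^ 2 := by
    apply pow_le_pow_left₀ (by positivity) h1
  have h3 := four_E A N wa wb
  nlinarith [sq_nonneg (wa - wb)]

/-- `E = 0` forces `w_a + w_b ≤ A`. -/
theorem sum_le_of_E_zero (A N wa wb : F) (hA : 0 < A) (hN : 4 * N ≤ A ^ 2)
    (hE : (wa - A / 3) ^ 2 + (wa - A / 3) * (wb - A / 3) + (wb - A / 3) ^ 2 - N / 3 = 0) :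
    wa + wb ≤ A := by
  by_contra h
  rw [not_le] at h
  have h1 : A / 3 < wa + wb - 2 * A / 3 := by linarith
  have h2 : (A / 3) ^ 2 < (wa + wb - 2 * A / 3) ^ 2 := by
    apply pow_lt_pow_left₀ h1 (by positivity) (by norm_num)
  have h3 := four_E A N wa wb
  nlinarith [sq_nonneg (wa - wb)]

/-- ... and `E = 0 ∧ w_a + w_b = A` happens only at the CORNER: `w_a = w_b` and `4 N = A²` (`y = 0`),
so that `w_a = w_b = A/2`.  Off the corner an `E = 0` cell has `w_a + w_b < A` and is DEAD
(`det H̄(m') = -m' (A - w_a - w_b) < 0` for `m' > 0`). -/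
theorem corner_of_E_zero_sum_eq (A N wa wb : F) (hN : 4 * N ≤ A ^ 2)
    (hE : (wa - A / 3) ^ 2 + (wa - A / 3) * (wb - A / 3) + (wb - A / 3) ^ 2 - N / 3 = 0)
    (hs : wa + wb = A) : wa = wb ∧ 4 * N = A ^ 2 := by
  have h3 := four_E A N wa wb
  rw [hE] at h3
  have h4 : wa + wb - 2 * A / 3 = A / 3 := by linarith
  rw [h4] at h3
  have h5 : (wa - wb) ^ 2 = (4 * N - A ^ 2) / 3 := by linarith
  have h6 : (wa - wb) ^ 2 = 0 := by nlinarith [sq_nonneg (wa - wb)]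
  constructor
  · have := pow_eq_zero_iff (n := 2) (by norm_num) |>.mp h6
    linarith
  · nlinarith [sq_nonneg (wa - wb)]

/-- The n-law sign: for `0 < N`, `0 < w`, `n = -E/(N w) > 0 ↔ E < 0`. -/
theorem n_pos_iff (E N w : F) (hN : 0 < N) (hw : 0 < w) : 0 < -E / (N * w) ↔ E < 0 := by
  rw [div_pos_iff_of_pos_right (mul_pos hN hw), neg_pos]

/-- At the corner of a rational class (`4 N = A²`, `w_a = w_b = A/2`): `E = 0`. -/
theorem E_corner (A N : F) (hN : 4 * N = A ^ 2) :
    (A / 2 - A / 3) ^ 2 + (A / 2 - A / 3) * (A / 2 - A / 3) + (A / 2 - A / 3) ^ 2 - N / 3 = 0 := by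
  have : N = A ^ 2 / 4 := by
    field_simp
    linarith
  subst this
  ring

/-- At the corner `H̄(m') = (2/A - m') ττ*` is positive semidefinite iff `m' ≤ 2/A`
(the scalar factor is non-negative): `sup m' = 2/A`. -/
theorem corner_sup (A m : F) : 0 ≤ 2 / A - m ↔ m ≤ 2 / A := by
  rw [sub_nonneg]

end Summit.Ventures.HSemireg.LiveLineLaw
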